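import Summits.Langlands.Langlands.Theses.PhantomRMYoshida
import Literature.NumberTheory.GaloisRepresentations.PadicComplexEmbedding
import Literature.NumberTheory.GaloisRepresentations.ModNCyclotomicCharacter
import Literature.NumberTheory.Automorphic.GLnAdelicStructureProofs

/-!
# Disproof work file for crux `StableYoshidaCongruence` (item stmt-Langlands-13640) — cycle 3

VERDICT (cycle 3): RESISTS.  No refutation.  This file is the standing adversary's Lean record
(cdisprove units g1 2026-08-15T22Z, g2 23Z, g3 = this cycle).  Cycles 1–2 attached their files as
item evidence only (`run/gate/evidence/…`, not mounted in seat jails); cycle 3 REBUILDS the Lean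
content self-contained and publishes it to the tree (`Cruxes/StableYoshidaCongruence/Disproof.lean`).
Prose lives in docstrings; every `theorem` below is sorry-free unless it sits in § NearMisses.

## Findings index

* §0 `crux_iff` — the crux unfolded into named pieces (`Sh`, `AutGL2`, `AutGL4`, `DetCond`,
  `NonConj`, `CruxAt`), by `Iff.rfl`.
* §1 Non-vacuity of the outer data in Lean: `nonempty_iota`, `hcpt4`, `hcpt2` (so neither the
  hypothesis `AutGL2` nor the conclusion is vacuously true/false through an empty binder type).
* §2 THE AUTOMORPHIC WALL as a theorem: `exists_cuspForm_of_not_crux` — any Lean proof of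
  `¬ StableYoshidaCongruence` yields a cuspidal automorphic representation of `GL₂(𝔸_ℚ)` with a
  Satake parameter at some finite place, an object nobody has constructed in the tree.  Hence no
  `_false_without_H` theorem is reachable in Lean for ANY hypothesis `H` of this crux (all variants
  keep `AutGL2 σ`); the load-bearing analysis is on paper (§4).
* §3 Structure (Lean): `Irr'` (irreducible-witness weakening) with `irr'_of_crux`,
  `irr'_of_sector`, `closes_irr'` (the route closes with `Irr'` in place of the crux, same glue);
  `IrrLift` / `lifting_imp_crux` / `crux_imp_lifting` (modulo the route's own target the crux is the
  purely Galois-side irregular-weight lifting statement); `RigidPair`, `not_crux_of_rigidPair`,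
  `rigidPair_of_not_crux_of_sector` (a disproof compatible with conjunct (B) must exhibit a rigid
  pair, and any rigid pair kills the crux with no automorphic input).
* §4 Load-bearing analysis (paper, docstring `loadBearing`): only `∃ ρ, Sh ρ` is load-bearing and
  it only ever certifies the REDUCIBLE witness; `AutGL2`, `DetCond.2`, `NonConj` are decoration
  modulo KW / the witness; "some level" is load-bearing (Poor–Yuen).
* §5 Regime table (paper, docstring `regimes`), cycle-3 additions: (D1) for a dihedral pair from one
  quadratic `K` (real or imaginary, `p` split) the crux HOLDS whenever the aligned ratio
  `θ̄₁/θ̄₂` lies in the image of `φ ↦ φ^{1-c}` (plus, for `K` real, the parity `φ̄(c_w)φ̄(c_w') = -1`)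
  — subsumes cycle 2's R3″ (`μ̄²`, odd order); (D2) CORRECTION of cycle 2's "K-real Hilbert
  Eisenstein residue": every `K`-imprimitive irreducible Sh-lift is tensor-decomposable or induced
  from a quartic field (projective-descent argument), so polarised Hilbert newforms add no case;
  (D3) the naive "det τ = ε⁻¹|_K" induction mechanism only reaches conjugate pairs `σ̄' ≅ σ̄`.
* §6 What a kill needs (docstring `whatAKillNeeds`): a RIGID PAIR = an irregular-weight
  non-lifting theorem for `GSp₄/ℚ`, HT `(0,0,1,1)`, expected dimension `-1`; no instance known, no
  parity/sign obstruction exists on the stable side; not reachable by computation.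
-/

set_option linter.dupNamespace false

namespace Summit.Langlands.Langlands.Cruxes.StableYoshidaCongruence.Disproof

open Literature.NumberTheory.GaloisRepresentations Literature.NumberTheory.Automorphic
open Summit.Langlands.Langlands.Theses.PhantomRMYoshida
open IsDedekindDomain

noncomputable section

/-! ## §0 The crux, unfolded into named pieces -/

section Names

variable (p : ℕ) [Fact p.Prime] (k : Type) [Field k] [CharP k p] [TopologicalSpace k]
  [DiscreteTopology k]

/-- `ε̄ : Γ_ℚ → (ℤ/p)ˣ`, the mod-`p` cyclotomic character exactly as spelled in the route file
(Mathlib's `modularCyclotomicCharacter` on `ℚ̄`, composed with `Γ_ℚ → Aut ℚ̄`). -/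
def epsBar : Field.absoluteGaloisGroup ℚ →* (ZMod p)ˣ :=
  (modularCyclotomicCharacter (AlgebraicClosure ℚ)
      (HasEnoughRootsOfUnity.natCard_rootsOfUnity (AlgebraicClosure ℚ) p)).comp
    (MulSemiringAction.toRingAut (Field.absoluteGaloisGroup ℚ) (AlgebraicClosure ℚ))

/-- The multiplier function `g ↦ ε(g)⁻¹ ∈ ℚ̄_p` of the route (cohomological convention). -/
def invCyc : Field.absoluteGaloisGroup ℚ → PadicAlgCl p := fun g =>
  algebraMap ℚ_[p] (PadicAlgCl p)
    ((((GaloisRep.cyclotomicCharacter ℚ p g)⁻¹ : ℤ_[p]ˣ) : ℤ_[p]) : ℚ_[p])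

variable {p k}

/-- `Sh red σ σ' r`: the SHAPE of a 4-dimensional `r : Γ_ℚ → GL₄(ℚ̄_p)` demanded by the crux —
symplectic with multiplier `ε⁻¹`, Greenberg-ordinary of shape `(0,0,1,1)` and residually
distinguished at `p`, and residually of Yoshida type `(σ, σ')` through `red` (a.e. Frobenius
polynomial is `p`-integral and reduces to `charpoly σ · charpoly σ'`).  Verbatim the route's
`let Sh`. -/
def Sh (red : Valued.integer (PadicAlgCl p) →+* k) (σ σ' : FramedGaloisRep ℚ k 2)
    (r : FramedGaloisRep ℚ (PadicAlgCl p) 4) : Prop :=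
  r.IsSymplecticWithMultiplierFun (invCyc p) ∧
  (∀ v : HeightOneSpectrum (NumberField.RingOfIntegers ℚ),
      ((p : ℕ) : NumberField.RingOfIntegers ℚ) ∈ v.asIdeal →
        r.IsGreenbergOrdinaryOfShapeAt v ![0, 0, 1, 1] ∧ r.IsResiduallyDistinguishedAt v ![0, 0, 1, 1]) ∧
  (∀ᶠ v : HeightOneSpectrum (NumberField.RingOfIntegers ℚ) in Filter.cofinite,
      r.IsUnramifiedAt v ∧ σ.IsUnramifiedAt v ∧ σ'.IsUnramifiedAt v ∧
        ∃ (P : Polynomial (Valued.integer (PadicAlgCl p))) (P₁ P₂ : Polynomial k),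
          r.HasFrobCharpolyAt v (P.map (Valued.integer (PadicAlgCl p)).subtype) ∧
            σ.HasFrobCharpolyAt v P₁ ∧ σ'.HasFrobCharpolyAt v P₂ ∧ P.map red = P₁ * P₂)

/-- `AutGL2 red s`: `s : Γ_ℚ → GL₂(k)` is residually automorphic on `GL₂` in the summit's
L-normalisation (the output of support item `SerreKWAutomorphicGL2`).  Verbatim the route's
`let AutGL2`. -/
def AutGL2 (red : Valued.integer (PadicAlgCl p) →+* k) (s : FramedGaloisRep ℚ k 2) : Prop :=
  ∀ (hcpt₂ : isCompact_glFiniteIntegralLevel 2 ℚ) (ι : PadicAlgCl p ≃+* ℂ),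
    ∃ π₂ : CuspidalAutomorphicRepData 2 ℚ hcpt₂, π₂.1.IsLAlgebraic ∧
      ∀ᶠ v : HeightOneSpectrum (NumberField.RingOfIntegers ℚ) in Filter.cofinite,
        ∃ (a : Multiset ℂ) (P : Polynomial (Valued.integer (PadicAlgCl p))) (Pb : Polynomial k),
          π₂.1.HasSatakeParamAt v a ∧
            P.map (Valued.integer (PadicAlgCl p)).subtype = arithFrobPolyOfSatake ι v.residueCard 1 a ∧
              s.IsUnramifiedAt v ∧ s.HasFrobCharpolyAt v Pb ∧ P.map red = Pb

variable (p) in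
/-- `AutGL4 hcpt ι r`: `r : Γ_ℚ → GL₄(ℚ̄_p)` is automorphic (a.e. Satake–Frobenius matching with an
L-algebraic cuspidal `π` on `GL₄(𝔸_ℚ)`), the inlined `IsAutomorphicAE` clause. -/
def AutGL4 (hcpt : isCompact_glFiniteIntegralLevel 4 ℚ) (ι : PadicAlgCl p ≃+* ℂ)
    (r : FramedGaloisRep ℚ (PadicAlgCl p) 4) : Prop :=
  ∃ π : CuspidalAutomorphicRepData 4 ℚ hcpt, π.1.IsLAlgebraic ∧
    ∀ᶠ v : HeightOneSpectrum (NumberField.RingOfIntegers ℚ) in Filter.cofinite,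
      ∃ a : Multiset ℂ, π.1.HasSatakeParamAt v a ∧ r.IsUnramifiedAt v ∧
        r.HasFrobCharpolyAt v (arithFrobPolyOfSatake ι v.residueCard 1 a)

variable (p) in
/-- `DetCond σ σ'`: `det σ = ε̄⁻¹` and `det σ' = det σ`. -/
def DetCond (σ σ' : FramedGaloisRep ℚ k 2) : Prop :=
  ∀ g, FramedRep.det σ g = (Units.map (ZMod.castHom (dvd_refl p) k).toMonoidHom (epsBar p g))⁻¹ ∧
    FramedRep.det σ' g = FramedRep.det σ g

/-- `NonConj σ σ'`: `σ'` is not `GL₂(k)`-conjugate to `σ`. -/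
def NonConj (σ σ' : FramedGaloisRep ℚ k 2) : Prop :=
  ¬ ∃ g : GL (Fin 2) k, ∀ x, g * σ x * g⁻¹ = σ' x

variable (p k) in
/-- The crux AT fixed outer data `(p, k, red, σ, σ')`. -/
def CruxAt (red : Valued.integer (PadicAlgCl p) →+* k) (σ σ' : FramedGaloisRep ℚ k 2) : Prop :=
  AutGL2 red σ → AutGL2 red σ' → σ.toGaloisRep.IsIrreducible → σ'.toGaloisRep.IsIrreducible →
    DetCond p σ σ' → NonConj σ σ' → (∃ ρ : FramedGaloisRep ℚ (PadicAlgCl p) 4, Sh red σ σ' ρ) →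
      ∀ (hcpt : isCompact_glFiniteIntegralLevel 4 ℚ) (ι : PadicAlgCl p ≃+* ℂ),
        ∃ ρ₀ : FramedGaloisRep ℚ (PadicAlgCl p) 4,
          ρ₀.toGaloisRep.IsIrreducible ∧ Sh red σ σ' ρ₀ ∧ AutGL4 p hcpt ι ρ₀

end Names

/-- **§0. The crux is literally `∀ p ≠ 2, ∀ k red σ σ', CruxAt p k red σ σ'`** (the route's `let`s
zeta-reduce to the named pieces above). -/
theorem crux_iff :
    StableYoshidaCongruence ↔
      ∀ (p : ℕ) [Fact p.Prime], p ≠ 2 → ∀ (k : Type) [Field k] [CharP k p] [IsAlgClosed k]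
        [TopologicalSpace k] [DiscreteTopology k] (red : Valued.integer (PadicAlgCl p) →+* k)
        (σ σ' : FramedGaloisRep ℚ k 2), CruxAt p k red σ σ' :=
  Iff.rfl

/-! ## §1 Non-vacuity of the outer data -/

/-- `ι : ℚ̄_p ≃+* ℂ` exists for every `p` (both algebraically closed of characteristic `0` and
cardinality `𝔠`; tree lemma `nonempty_algebraicClosure_padic_ringEquiv_complex`).  So the `∀ ι` in
`AutGL2` and in the conclusion ranges over a NONEMPTY type: `AutGL2 σ` is not vacuously true and
the conclusion is not vacuously provable. -/
theorem nonempty_iota (p : ℕ) [Fact p.Prime] : Nonempty (PadicAlgCl p ≃+* ℂ) :=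
  Literature.NumberTheory.GaloisRepresentations.NumberField.nonempty_algebraicClosure_padic_ringEquiv_complex p

/-- The level-compactness witness for `GL₄/ℚ` (tree theorem `isCompact_glFiniteIntegralLevel_holds`):
the binder `hcpt` of the conclusion is inhabited. -/
theorem hcpt4 : isCompact_glFiniteIntegralLevel 4 ℚ := isCompact_glFiniteIntegralLevel_holds 4 ℚ

/-- The level-compactness witness for `GL₂/ℚ`: the binder `hcpt₂` of `AutGL2` is inhabited, so
`AutGL2 σ` is a genuine existence assertion about cusp forms on `GL₂(𝔸_ℚ)`. -/
theorem hcpt2 : isCompact_glFiniteIntegralLevel 2 ℚ := isCompact_glFiniteIntegralLevel_holds 2 ℚ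

/-- `ℚ` has infinitely many finite places (`HeightOneSpectrum (𝓞 ℚ) ≃ Nat.Primes`, Mathlib
`Rat.HeightOneSpectrum.primesEquiv`), so `∀ᶠ v in cofinite` is a non-trivial filter statement:
an a.e. clause is never satisfied "because there are no places". -/
instance infinite_heightOneSpectrum_rat :
    Infinite (HeightOneSpectrum (NumberField.RingOfIntegers ℚ)) :=
  haveI : Infinite Nat.Primes := Set.infinite_coe_iff.mpr Nat.infinite_setOf_prime
  Infinite.of_injective _
    (Rat.HeightOneSpectrum.primesEquiv (R := NumberField.RingOfIntegers ℚ)).symm.injective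

/-! ## §2 The automorphic wall, as a theorem -/

/-- **The automorphic wall.**  From any proof of `¬ StableYoshidaCongruence` one extracts a
cuspidal automorphic representation `π₂` of `GL₂(𝔸_ℚ)` (an honest `CuspidalAutomorphicRepData`:
`W ≤ cuspFormsGL`, a NON-ZERO cusp form, Hecke-eigen Satake data) together with a finite place at
which it has a Satake parameter.  The tree constructs no such object (no cusp form on any `GL_n`,
`n ≥ 2`, has been written down in Lean), so a Lean refutation of this crux is at least as hard as
formalising the existence of one classical eigenform adelically — independently of the mathematics
of the crux.  Consequently no `_false_without_H` theorem (crux with a hypothesis dropped, proved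
false) is reachable in Lean for any `H`: every such variant keeps `AutGL2 σ` among its hypotheses,
and refuting it needs the same `π₂`.  (Cycles 1–2 audited the wall at
`AutomorphicRepsGL.lean:252/290`; this theorem is its formal shadow.) -/
theorem exists_cuspForm_of_not_crux (h : ¬ StableYoshidaCongruence) :
    ∃ (p : ℕ) (_ : Fact p.Prime) (π₂ : CuspidalAutomorphicRepData 2 ℚ hcpt2)
      (v : HeightOneSpectrum (NumberField.RingOfIntegers ℚ)) (a : Multiset ℂ),
        π₂.1.IsLAlgebraic ∧ π₂.1.HasSatakeParamAt v a := by
  rw [crux_iff] at h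
  push Not at h
  obtain ⟨p, hp, -, k, _, _, _, _, _, red, σ, σ', hcrux⟩ := h
  refine ⟨p, hp, ?_⟩
  -- `CruxAt` is an implication chain; its failure hands us `AutGL2 red σ`.
  have hA : AutGL2 red σ := by
    by_contra hA
    exact hcrux (fun h₁ => absurd h₁ hA)
  obtain ⟨ι⟩ := nonempty_iota p
  obtain ⟨π₂, hL, hae⟩ := hA hcpt2 ι
  obtain ⟨v, a, P, Pb, hv, -⟩ := hae.exists
  exact ⟨π₂, v, a, hL, hv⟩

/-! ## §3 Structure: what the route needs, and the Galois-side core -/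

section Structure

variable {p : ℕ} [Fact p.Prime] {k : Type} [Field k] [CharP k p] [TopologicalSpace k]
  [DiscreteTopology k]

/-! ### §3.1 Oddness is free (the crux rightly omits `IsOdd`) -/

/-- `ε̄(c) = -1` for every complex conjugation `c ∈ Γ_ℚ` (tree:
`modNCyclotomicCharacter_of_isComplexConjugation`; `epsBar p` IS `modNCyclotomicCharacter ℚ p`). -/
theorem epsBar_of_isComplexConjugation {φ : ℚ →+* ℝ} {c : Field.absoluteGaloisGroup ℚ}
    (hc : IsComplexConjugation φ c) : epsBar p c = -1 := by
  haveI : NeZero (p : ℚ) := ⟨Nat.cast_ne_zero.mpr (Fact.out : p.Prime).ne_zero⟩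
  have h := modNCyclotomicCharacter_of_isComplexConjugation (K := ℚ) (N := p) hc
  refine Units.ext ?_
  change ((modNCyclotomicCharacter ℚ p c : (ZMod p)ˣ) : ZMod p) = _
  rw [h]
  simp

/-- **Oddness of `σ` and `σ'` follows from `DetCond`** (`det σ(c) = ε̄(c)⁻¹ = -1`), for every `p`
(no `p ≠ 2` needed: at `p = 2`, `-1 = 1`).  So the crux's omission of the sector's `IsOdd`
hypotheses loses nothing, and `SerreKWAutomorphicGL2` can be fed from `DetCond` alone. -/
theorem isOdd_of_detCond {σ σ' : FramedGaloisRep ℚ k 2} (h : DetCond p σ σ') :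
    σ.IsOdd ∧ σ'.IsOdd := by
  have key : ∀ (φ : ℚ →+* ℝ) (c : Field.absoluteGaloisGroup ℚ), IsComplexConjugation φ c →
      FramedRep.det σ c = -1 := by
    intro φ c hc
    rw [(h c).1, epsBar_of_isComplexConjugation hc]
    ext
    simp
  exact ⟨fun φ c hc => key φ c hc, fun φ c hc => ((h c).2.trans (key φ c hc) : _)⟩

/-! ### §3.2 The target at fixed data, and the irreducible-witness weakening `Irr'` -/

variable (p k) in
/-- The route's TARGET `PhantomRMSector` at fixed outer data. -/
def SectorAt (red : Valued.integer (PadicAlgCl p) →+* k) (σ σ' : FramedGaloisRep ℚ k 2) : Prop :=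
  ∀ (hcpt : isCompact_glFiniteIntegralLevel 4 ℚ) (ι : PadicAlgCl p ≃+* ℂ)
    (ρ : FramedGaloisRep ℚ (PadicAlgCl p) 4),
    σ.IsOdd → σ'.IsOdd → σ.toGaloisRep.IsIrreducible → σ'.toGaloisRep.IsIrreducible →
      DetCond p σ σ' → NonConj σ σ' → ρ.toGaloisRep.IsIrreducible → Sh red σ σ' ρ →
        AutGL4 p hcpt ι ρ

/-- `PhantomRMSector` unfolded (by `Iff.rfl`). -/
theorem sector_iff :
    PhantomRMSector ↔
      ∀ (p : ℕ) [Fact p.Prime], p ≠ 2 → ∀ (k : Type) [Field k] [CharP k p] [IsAlgClosed k]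
        [TopologicalSpace k] [DiscreteTopology k] (red : Valued.integer (PadicAlgCl p) →+* k)
        (σ σ' : FramedGaloisRep ℚ k 2), SectorAt p k red σ σ' :=
  Iff.rfl

variable (p k) in
/-- `Irr'At`: the crux at fixed data with the witness hypothesis STRENGTHENED to an irreducible
witness `∃ ρ, ρ irreducible ∧ Sh ρ` (byte-identical otherwise). -/
def Irr'At (red : Valued.integer (PadicAlgCl p) →+* k) (σ σ' : FramedGaloisRep ℚ k 2) : Prop :=
  AutGL2 red σ → AutGL2 red σ' → σ.toGaloisRep.IsIrreducible → σ'.toGaloisRep.IsIrreducible →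
    DetCond p σ σ' → NonConj σ σ' →
      (∃ ρ : FramedGaloisRep ℚ (PadicAlgCl p) 4, ρ.toGaloisRep.IsIrreducible ∧ Sh red σ σ' ρ) →
        ∀ (hcpt : isCompact_glFiniteIntegralLevel 4 ℚ) (ι : PadicAlgCl p ≃+* ℂ),
          ∃ ρ₀ : FramedGaloisRep ℚ (PadicAlgCl p) 4,
            ρ₀.toGaloisRep.IsIrreducible ∧ Sh red σ σ' ρ₀ ∧ AutGL4 p hcpt ι ρ₀

/-- `Irr'`: the irreducible-witness weakening of the crux, globally. -/
def Irr' : Prop :=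
  ∀ (p : ℕ) [Fact p.Prime], p ≠ 2 → ∀ (k : Type) [Field k] [CharP k p] [IsAlgClosed k]
    [TopologicalSpace k] [DiscreteTopology k] (red : Valued.integer (PadicAlgCl p) →+* k)
    (σ σ' : FramedGaloisRep ℚ k 2), Irr'At p k red σ σ'

/-- The crux implies its weakening. -/
theorem irr'At_of_cruxAt {red : Valued.integer (PadicAlgCl p) →+* k} {σ σ' : FramedGaloisRep ℚ k 2}
    (h : CruxAt p k red σ σ') : Irr'At p k red σ σ' :=
  fun h₁ h₂ h₃ h₄ h₅ h₆ ⟨ρ, _, hρ⟩ => h h₁ h₂ h₃ h₄ h₅ h₆ ⟨ρ, hρ⟩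

theorem irr'_of_crux (h : StableYoshidaCongruence) : Irr' :=
  fun p _ hp k _ _ _ _ _ red σ σ' => irr'At_of_cruxAt (crux_iff.mp h p hp k red σ σ')

/-- **`Irr'` is a corollary of the route's own TARGET** (`ρ₀ :=` the irreducible witness itself,
automorphic by the sector; oddness from `DetCond`).  Pointwise form. -/
theorem irr'At_of_sectorAt {red : Valued.integer (PadicAlgCl p) →+* k}
    {σ σ' : FramedGaloisRep ℚ k 2} (hX : SectorAt p k red σ σ') : Irr'At p k red σ σ' := by
  intro _ _ h₃ h₄ h₅ h₆ hw hcpt ι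
  obtain ⟨ρ, hirr, hSh⟩ := hw
  exact ⟨ρ, hirr, hSh, hX hcpt ι ρ (isOdd_of_detCond h₅).1 (isOdd_of_detCond h₅).2 h₃ h₄ h₅ h₆
    hirr hSh⟩

theorem irr'_of_sector (hX : PhantomRMSector) : Irr' :=
  fun p _ hp k _ _ _ _ _ red σ σ' => irr'At_of_sectorAt (sector_iff.mp hX p hp k red σ σ')

/-- **The route closes with `Irr'` in place of the crux**, by the SAME glue term as the deciding
theorem `closes` (the sector's `ρ` is irreducible, so the glue only ever feeds an irreducible
witness to crux 3).  Hence the filed crux = `Irr'` + a surplus that conjunct (B) does not need: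
existence, for pairs with a merely REDUCIBLE `Sh`-witness, of an irreducible automorphic one. -/
theorem closes_irr' (hKW : SerreKWAutomorphicGL2) (hS : Irr') (hL : ResiduallyYoshidaLifting)
    (hJ : PhantomRMJunction) : _root_.Langlands :=
  hJ (fun p _ hp k _ _ _ _ _ red σ σ' hcpt ι ρ hσ hσ' hirr hirr' hdet hnc hρirr hSh =>
    (hS p hp k red σ σ' (hKW p k red σ hσ hirr) (hKW p k red σ' hσ' hirr') hirr hirr' hdet hnc
        ⟨ρ, hρirr, hSh⟩ hcpt ι).elim
      fun ρ₀ h₀ => hL p hp k red σ σ' hcpt ι ρ₀ ρ hσ hσ' hirr hirr' hdet hnc h₀.1 h₀.2.1 h₀.2.2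
        hρirr hSh)

/-- Conversely, given the KW gate and crux 2 (relative lifting), `Irr'` gives back the sector:
so **modulo the other items of the route, `Irr'` is EXACTLY target-strength**. -/
theorem sector_of_irr' (hKW : SerreKWAutomorphicGL2) (hL : ResiduallyYoshidaLifting) (hS : Irr') :
    PhantomRMSector :=
  fun p _ hp k _ _ _ _ _ red σ σ' hcpt ι ρ hσ hσ' hirr hirr' hdet hnc hρirr hSh =>
    (hS p hp k red σ σ' (hKW p k red σ hσ hirr) (hKW p k red σ' hσ' hirr') hirr hirr' hdet hnc
        ⟨ρ, hρirr, hSh⟩ hcpt ι).elim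
      fun ρ₀ h₀ => hL p hp k red σ σ' hcpt ι ρ₀ ρ hσ hσ' hirr hirr' hdet hnc h₀.1 h₀.2.1 h₀.2.2
        hρirr hSh

theorem sector_iff_irr' (hKW : SerreKWAutomorphicGL2) (hL : ResiduallyYoshidaLifting) :
    PhantomRMSector ↔ Irr' :=
  ⟨irr'_of_sector, sector_of_irr' hKW hL⟩

/-! ### §3.3 The Galois-side core: irregular-weight symplectic lifting -/

variable (p k) in
/-- `IrrLiftAt`: at fixed data satisfying the crux's hypotheses, if the pair has SOME `Sh`-witness
then it has an IRREDUCIBLE one.  Purely Galois-theoretic apart from the (KW-redundant) `AutGL2`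
hypotheses; no automorphic conclusion. -/
def IrrLiftAt (red : Valued.integer (PadicAlgCl p) →+* k) (σ σ' : FramedGaloisRep ℚ k 2) : Prop :=
  AutGL2 red σ → AutGL2 red σ' → σ.toGaloisRep.IsIrreducible → σ'.toGaloisRep.IsIrreducible →
    DetCond p σ σ' → NonConj σ σ' → (∃ ρ : FramedGaloisRep ℚ (PadicAlgCl p) 4, Sh red σ σ' ρ) →
      ∃ ρ₁ : FramedGaloisRep ℚ (PadicAlgCl p) 4, ρ₁.toGaloisRep.IsIrreducible ∧ Sh red σ σ' ρ₁

/-- `IrregularSymplecticLifting`: every eligible pair with a Greenberg-ordinary `p`-distinguished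
symplectic-`ε⁻¹` lift of shape `(0,0,1,1)` has an IRREDUCIBLE such lift (at some level). -/
def IrregularSymplecticLifting : Prop :=
  ∀ (p : ℕ) [Fact p.Prime], p ≠ 2 → ∀ (k : Type) [Field k] [CharP k p] [IsAlgClosed k]
    [TopologicalSpace k] [DiscreteTopology k] (red : Valued.integer (PadicAlgCl p) →+* k)
    (σ σ' : FramedGaloisRep ℚ k 2), IrrLiftAt p k red σ σ'

/-- The crux implies the lifting statement outright (instantiate its conclusion at the
inhabited `hcpt4`, `ι` and forget automorphy). -/
theorem irrLiftAt_of_cruxAt {red : Valued.integer (PadicAlgCl p) →+* k}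
    {σ σ' : FramedGaloisRep ℚ k 2} (h : CruxAt p k red σ σ') : IrrLiftAt p k red σ σ' := by
  intro h₁ h₂ h₃ h₄ h₅ h₆ hw
  obtain ⟨ι⟩ := nonempty_iota p
  obtain ⟨ρ₀, hirr, hSh, -⟩ := h h₁ h₂ h₃ h₄ h₅ h₆ hw hcpt4 ι
  exact ⟨ρ₀, hirr, hSh⟩

theorem crux_imp_lifting (h : StableYoshidaCongruence) : IrregularSymplecticLifting :=
  fun p _ hp k _ _ _ _ _ red σ σ' => irrLiftAt_of_cruxAt (crux_iff.mp h p hp k red σ σ')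

/-- **Target + lifting ⇒ crux** (pointwise): the irreducible lift is automorphic by the sector. -/
theorem cruxAt_of_sectorAt_of_irrLiftAt {red : Valued.integer (PadicAlgCl p) →+* k}
    {σ σ' : FramedGaloisRep ℚ k 2} (hX : SectorAt p k red σ σ') (hLift : IrrLiftAt p k red σ σ') :
    CruxAt p k red σ σ' := by
  intro h₁ h₂ h₃ h₄ h₅ h₆ hw hcpt ι
  obtain ⟨ρ₁, hirr, hSh⟩ := hLift h₁ h₂ h₃ h₄ h₅ h₆ hw
  exact ⟨ρ₁, hirr, hSh, hX hcpt ι ρ₁ (isOdd_of_detCond h₅).1 (isOdd_of_detCond h₅).2 h₃ h₄ h₅ h₆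
    hirr hSh⟩

theorem lifting_imp_crux (hX : PhantomRMSector) (hLift : IrregularSymplecticLifting) :
    StableYoshidaCongruence :=
  crux_iff.mpr fun p _ hp k _ _ _ _ _ red σ σ' =>
    cruxAt_of_sectorAt_of_irrLiftAt (sector_iff.mp hX p hp k red σ σ') (hLift p hp k red σ σ')

/-- **Modulo the route's own target, the crux IS the Galois-side lifting statement.**  Hence a
disproof of the crux either refutes conjunct (B) of the summit for an odd symplectic weight-(2,2)
`ρ` over `ℚ` (nobody expects this) or exhibits a RIGID PAIR (§3.4). -/
theorem crux_iff_lifting (hX : PhantomRMSector) :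
    StableYoshidaCongruence ↔ IrregularSymplecticLifting :=
  ⟨crux_imp_lifting, lifting_imp_crux hX⟩

/-- Two trivial ways a fixed datum satisfies the crux (used in the regime table, §5): an
irreducible automorphic lift is known (`cruxAt_of_automorphic_lift`), or there is no witness at
all (`cruxAt_of_no_witness`, e.g. supersingular or irreducible-at-`p` constituents). -/
theorem cruxAt_of_automorphic_lift {red : Valued.integer (PadicAlgCl p) →+* k}
    {σ σ' : FramedGaloisRep ℚ k 2}
    (h : ∀ (hcpt : isCompact_glFiniteIntegralLevel 4 ℚ) (ι : PadicAlgCl p ≃+* ℂ),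
      ∃ ρ₀ : FramedGaloisRep ℚ (PadicAlgCl p) 4,
        ρ₀.toGaloisRep.IsIrreducible ∧ Sh red σ σ' ρ₀ ∧ AutGL4 p hcpt ι ρ₀) :
    CruxAt p k red σ σ' :=
  fun _ _ _ _ _ _ _ => h

theorem cruxAt_of_no_witness {red : Valued.integer (PadicAlgCl p) →+* k}
    {σ σ' : FramedGaloisRep ℚ k 2} (h : ¬ ∃ ρ : FramedGaloisRep ℚ (PadicAlgCl p) 4, Sh red σ σ' ρ) :
    CruxAt p k red σ σ' :=
  fun _ _ _ _ _ _ hw => absurd hw h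

/-! ### §3.4 Rigid pairs -/

variable (p k) in
/-- A **rigid pair** at fixed data: all hypotheses of the crux hold (including a `Sh`-witness,
necessarily reducible) but NO irreducible `Sh`-lift exists at any level. -/
def RigidPairAt (red : Valued.integer (PadicAlgCl p) →+* k) (σ σ' : FramedGaloisRep ℚ k 2) : Prop :=
  AutGL2 red σ ∧ AutGL2 red σ' ∧ σ.toGaloisRep.IsIrreducible ∧ σ'.toGaloisRep.IsIrreducible ∧
    DetCond p σ σ' ∧ NonConj σ σ' ∧ (∃ ρ : FramedGaloisRep ℚ (PadicAlgCl p) 4, Sh red σ σ' ρ) ∧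
      ∀ ρ₁ : FramedGaloisRep ℚ (PadicAlgCl p) 4, Sh red σ σ' ρ₁ → ¬ ρ₁.toGaloisRep.IsIrreducible

/-- `RigidPair`: some odd prime and some eligible pair form a rigid pair. -/
def RigidPair : Prop :=
  ∃ (p : ℕ) (_ : Fact p.Prime), p ≠ 2 ∧ ∃ (k : Type) (_ : Field k) (_ : CharP k p)
    (_ : IsAlgClosed k) (_ : TopologicalSpace k) (_ : DiscreteTopology k)
    (red : Valued.integer (PadicAlgCl p) →+* k) (σ σ' : FramedGaloisRep ℚ k 2), RigidPairAt p k red σ σ'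

theorem rigidPairAt_iff_not_irrLiftAt {red : Valued.integer (PadicAlgCl p) →+* k}
    {σ σ' : FramedGaloisRep ℚ k 2} : RigidPairAt p k red σ σ' ↔ ¬ IrrLiftAt p k red σ σ' := by
  constructor
  · rintro ⟨h₁, h₂, h₃, h₄, h₅, h₆, hw, hno⟩ hLift
    obtain ⟨ρ₁, hirr, hSh⟩ := hLift h₁ h₂ h₃ h₄ h₅ h₆ hw
    exact hno ρ₁ hSh hirr
  · intro h
    simp only [IrrLiftAt, not_forall, not_exists, not_and] at h
    obtain ⟨h₁, h₂, h₃, h₄, h₅, h₆, hw, hno⟩ := h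
    exact ⟨h₁, h₂, h₃, h₄, h₅, h₆, hw, fun ρ₁ hSh hirr => hno ρ₁ hirr hSh⟩

theorem rigidPair_iff_not_lifting : RigidPair ↔ ¬ IrregularSymplecticLifting := by
  constructor
  · rintro ⟨p, hp, hp2, k, _, _, _, _, _, red, σ, σ', hR⟩ hLift
    exact rigidPairAt_iff_not_irrLiftAt.mp hR (hLift p hp2 k red σ σ')
  · intro h
    unfold IrregularSymplecticLifting at h
    push Not at h
    obtain ⟨p, hp, hp2, k, i₁, i₂, i₃, i₄, i₅, red, σ, σ', hR⟩ := h
    exact ⟨p, hp, hp2, k, i₁, i₂, i₃, i₄, i₅, red, σ, σ', rigidPairAt_iff_not_irrLiftAt.mpr hR⟩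

/-- **Any rigid pair kills the crux, with no automorphic input.** -/
theorem not_crux_of_rigidPair (h : RigidPair) : ¬ StableYoshidaCongruence :=
  fun hc => rigidPair_iff_not_lifting.mp h (crux_imp_lifting hc)

/-- **A disproof compatible with the target must exhibit a rigid pair.** -/
theorem rigidPair_of_not_crux_of_sector (hX : PhantomRMSector) (h : ¬ StableYoshidaCongruence) :
    RigidPair :=
  rigidPair_iff_not_lifting.mpr fun hLift => h (lifting_imp_crux hX hLift)

/-! ### §3.5 Hypothesis (H1) `AutGL2` is decoration modulo the KW gate -/

variable (p k) in
/-- The crux at fixed data with BOTH `AutGL2` hypotheses dropped. -/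
def CruxNoAutAt (red : Valued.integer (PadicAlgCl p) →+* k) (σ σ' : FramedGaloisRep ℚ k 2) : Prop :=
  σ.toGaloisRep.IsIrreducible → σ'.toGaloisRep.IsIrreducible → DetCond p σ σ' → NonConj σ σ' →
    (∃ ρ : FramedGaloisRep ℚ (PadicAlgCl p) 4, Sh red σ σ' ρ) →
      ∀ (hcpt : isCompact_glFiniteIntegralLevel 4 ℚ) (ι : PadicAlgCl p ≃+* ℂ),
        ∃ ρ₀ : FramedGaloisRep ℚ (PadicAlgCl p) 4,
          ρ₀.toGaloisRep.IsIrreducible ∧ Sh red σ σ' ρ₀ ∧ AutGL4 p hcpt ι ρ₀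

/-- Given the named-fact gate `SerreKWAutomorphicGL2` (Khare–Wintenberger in the summit's
normalisation, support item stmt-Langlands-12944), dropping (H1) changes nothing: oddness comes
from `DetCond` (`isOdd_of_detCond`) and KW supplies `AutGL2`.  So (H1) carries no content beyond
the gate; it is kept only so that the crux is typed fact-free. -/
theorem cruxNoAutAt_iff_of_KW [IsAlgClosed k] (hKW : SerreKWAutomorphicGL2)
    {red : Valued.integer (PadicAlgCl p) →+* k} {σ σ' : FramedGaloisRep ℚ k 2} :
    CruxNoAutAt p k red σ σ' ↔ CruxAt p k red σ σ' := by
  constructor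
  · exact fun h _ _ h₃ h₄ h₅ h₆ hw => h h₃ h₄ h₅ h₆ hw
  · intro h h₃ h₄ h₅ h₆ hw
    exact h (hKW p k red σ (isOdd_of_detCond h₅).1 h₃) (hKW p k red σ' (isOdd_of_detCond h₅).2 h₄)
      h₃ h₄ h₅ h₆ hw

/-! ### §3.6 The crux is symmetric in the pair (WLOG arguments are legitimate) -/

omit [CharP k p] [DiscreteTopology k] in
theorem sh_comm {red : Valued.integer (PadicAlgCl p) →+* k} {σ σ' : FramedGaloisRep ℚ k 2}
    {r : FramedGaloisRep ℚ (PadicAlgCl p) 4} : Sh red σ σ' r ↔ Sh red σ' σ r := by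
  unfold Sh
  refine and_congr Iff.rfl (and_congr Iff.rfl (Filter.eventually_congr
    (Filter.Eventually.of_forall fun v => ?_)))
  constructor
  · rintro ⟨h1, h2, h3, P, P₁, P₂, hP, hP₁, hP₂, hred⟩
    exact ⟨h1, h3, h2, P, P₂, P₁, hP, hP₂, hP₁, hred.trans (mul_comm _ _)⟩
  · rintro ⟨h1, h2, h3, P, P₁, P₂, hP, hP₁, hP₂, hred⟩
    exact ⟨h1, h3, h2, P, P₂, P₁, hP, hP₂, hP₁, hred.trans (mul_comm _ _)⟩

theorem detCond_comm {σ σ' : FramedGaloisRep ℚ k 2} (h : DetCond p σ σ') : DetCond p σ' σ :=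
  fun g => ⟨(h g).2.trans (h g).1, (h g).2.symm⟩

omit [CharP k p] [DiscreteTopology k] in
theorem nonConj_comm {σ σ' : FramedGaloisRep ℚ k 2} (h : NonConj σ σ') : NonConj σ' σ := by
  rintro ⟨g, hg⟩
  refine h ⟨g⁻¹, fun x => ?_⟩
  rw [← hg x]
  group

/-- **`CruxAt` is symmetric in `(σ, σ')`.** -/
theorem cruxAt_comm {red : Valued.integer (PadicAlgCl p) →+* k} {σ σ' : FramedGaloisRep ℚ k 2}
    (h : CruxAt p k red σ σ') : CruxAt p k red σ' σ := by
  intro h₁ h₂ h₃ h₄ h₅ h₆ hw hcpt ι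
  obtain ⟨ρ₀, hirr, hSh, hAut⟩ :=
    h h₂ h₁ h₄ h₃ (detCond_comm h₅) (nonConj_comm h₆) (hw.imp fun _ hρ => sh_comm.mp hρ) hcpt ι
  exact ⟨ρ₀, hirr, sh_comm.mp hSh, hAut⟩

end Structure

/-! ## §4 Load-bearing analysis (paper; Lean-blocked by §2)

Tags: [c1] = cycle 1, [c2] = cycle 2, [c3] = this cycle.  "H5" etc. name the hypotheses of
`CruxAt` in order: H1 = `AutGL2 σ`, H1' = `AutGL2 σ'`, H2/H2' = irreducibility of `σ`/`σ'`,
H3a = `det σ = ε̄⁻¹`, H3b = `det σ' = det σ`, H4 = `NonConj`, H5 = `∃ ρ, Sh ρ`; C1–C3 = the three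
conjuncts of the conclusion (irreducible / `Sh` / automorphic). -/

/-- **§4 `loadBearing` (paper).**

* H1, H1' — DECORATION modulo the KW gate (`cruxNoAutAt_iff_of_KW`, Lean). [c1]
* H2, H2' — load-bearing for the MECHANISM, not for truth as typed: with `σ` reducible the pair is
  Eisenstein/CAP territory; but note the crux with H2 dropped is not obviously false either (no
  counterexample known); kept. [c1]
* H3a — a case restriction (fixes the similitude to `ε̄⁻¹`, i.e. weight 2 trivial character);
  H3b and H4 are DERIVABLE from H5 (claim of [c2]; sketch): `σ̄' ≅ σ̄` would make the unramified
  constituent of `σ̄|_{Γ_p}` occur with even multiplicity in `ρ̄^ss|_{Γ_p}`, contradicting residual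
  distinguishedness (this settles H4); Brauer–Nesbitt gives `ρ̄^ss ≅ (ρ̄^ss)^∨ ⊗ ε̄⁻¹`, and with H3a
  this forces `σ̄' ≅ σ̄' ⊗ (ε̄⁻¹/det σ̄')`, i.e. H3b up to the exceptional case of a dihedral `σ̄'`
  with a quadratic self-twist `χ` and `det σ̄' = ε̄⁻¹χ` — there a residually non-degenerate form
  would pair `σ̄` with `σ̄'` and again contradict distinguishedness; [c3] did not re-verify the
  lattice step of that last clause, so provers should treat "H3b derivable" as a sketch. [c2,c3]
* H5 — THE load-bearing hypothesis: dropping it makes the crux false for trivial reasons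
  (supersingular pairs have no ordinary lift at all, so C2 fails for every `ρ₀`).  But H5 only ever
  certifies the REDUCIBLE witness: if any `Sh`-witness exists then both `σ̄|_{Γ_p}`, `σ̄'|_{Γ_p}`
  are ordinary-shaped and `p`-distinguished, Hida theory gives `p`-ordinary weight-2 newforms
  `f, g` (trivial character, some level) with `ρ̄_f^∨ ≅ σ̄`, `ρ̄_g^∨ ≅ σ̄'`, and `ρ_f^∨ ⊕ ρ_g^∨` is a
  `Sh`-witness (Ribet-lattice argument for the SUB-characters). So H5 ⟺ "(σ̄, σ̄') is an ordinary
  `p`-distinguished Yoshida pair", and carries no hidden irreducible information. [c2]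
* "some level" (no conductor bound in C3/C2) is load-bearing: at fixed small level stable weight-2
  forms need not exist (Poor–Yuen, arXiv:0912.0049, Thm 1.2: no non-lift weight-2 paramodular cusp
  form of prime level `< 277`). [c2]
* `red`, `k`, `ι`, `hcpt`: forced / inhabited (§1; [c1] proved `red` kills `𝔪`, so `red` is
  `𝒪_{ℚ̄_p} → 𝔽̄_p ↪ k`; finite-image `σ̄` over an arbitrary algebraically closed `k` is conjugate
  into `GL₂(𝔽̄_p)` by Brauer, so exotic `k` adds nothing). [c1,c3]
* Normalisations (multiplier `ε⁻¹`, `det σ̄ = ε̄⁻¹`, shape `(0,0,1,1)` with HT(ε) = -1 and the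
  unramified block FIRST, `arithFrobPolyOfSatake … 1` on both sides) are mutually consistent; the
  Greenberg orientation is the semistable one (the opposite orientation would admit non-de-Rham
  extensions, cf. the stmt-Langlands-3647 finding that motivated `IsGreenbergOrdinaryOfShapeAt`);
  the two separate frame-existentials in `Sh` (Greenberg frame / distinguished frame) carry
  frame-independent content because the unramified and the `ε̄⁻¹`-twisted constituents of
  `ρ|_{Γ_p}` are distinguished by inertia (`p` odd). [c2,c3] -/
theorem loadBearing : True := trivial

/-! ## §5 Regime table (paper) -/

/-- **§5 `regimes` (paper).**  Throughout `(σ̄, σ̄')` satisfies H2–H5, `p` odd.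

R1 (twist pairs `σ̄' ≅ σ̄ ⊗ η`, `η` quadratic cutting out `E`) [c2]: `p` split or ramified in `E` ⇒
  no witness (vacuous); `p` inert in `E` ⇒ TRUE via `ρ₀ = ρ_f^∨ ⊗ Ind_E^ℚ(φ^{1-c})` (automorphic by
  BC + AI), `cruxAt_of_automorphic_lift`.
R2 (`p = 3`, `ρ̄` symplectically `𝔽₃`-rational, e.g. phantom-RM `σ̄ ⊕ σ̄^(3)`) [c1,c2]: the twisted
  Burkhardt moduli space is unirational with dense `ℚ`-points (Bruin–Filatov arXiv:2207.04393,
  Thm 1.2(4); BoxerEtAl2021 §10.2), genus-2 Jacobians with `Jac[3] ≅ ρ̄`, good ordinary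
  distinguished reduction (3-adic open condition) and `End = ℤ` exist and are modular by
  BCGP2025's 2-adic theorems (ideator cards `burkhardt-weddle-two-three-anchor`,
  `level-three-weierstrass-switch`) ⇒ `IrrLiftAt` holds ⇒ crux ⇐ target; not refutable there
  without refuting (B).
R3/D (dihedral pairs from ONE quadratic field `K`, `σ̄ = Ind_K θ̄₁`, `σ̄' = Ind_K θ̄₂`) — REWORKED
  in [c3], superseding [c2]'s R3, R3′, R3″:
  * `p` inert in `K` ⇒ no witness; `p` ramified ⇒ no witness unless `p = 3`.  So `p = w w'` splits;
    align `θ̄₁, θ̄₂` unramified at `w` (then `θ̄ᵢ|_{I_{w'}} = ε̄⁻¹`).  Put `χ̄' := θ̄₁/θ̄₂`; then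
    `χ̄' ∘ Ver = 1`, `χ̄'` is unramified at `p`, `χ̄'(Frob_w) ≠ 1 ≠ χ̄'(Frob_{w'})` (distinguishedness),
    and for `K` real `χ̄'` is totally even or totally odd.  The class of `χ̄'` modulo the subgroup
    `im(1-c) = {φ/φ^c}` does not depend on the alignment.
  * (D1, NEW, TRUE case) If `χ̄' ∈ im(1-c)` and, for `K` real, `χ̄'` is totally even, the crux
    HOLDS at the pair.  Construction: solve `φ̄^{1-c} = θ̄₁/θ̄₂^c` with `φ̄` unramified at `w`
    (adjust by a Dirichlet character; then automatically `φ̄|_{I_{w'}} = ε̄⁻¹`); `ρ̄ := Ind_K φ̄` is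
    irreducible (`θ̄₁ ≠ θ̄₂^c`), ordinary-shaped, and odd iff (`K` imaginary) or (`χ̄'` totally
    even); `θ̄ := θ̄₁ φ̄⁻¹` is unramified at `p`; `θ := Teich θ̄`, `m := θ ∘ Ver` (an even Dirichlet
    character, unramified at `p`); `W := Ind_K θ` is ORTHOGONAL with multiplier `m` (sign
    `m(c̃)/θ(c̃²) = +1`); `g :=` a `p`-ordinary weight-2 newform with nebentypus `m` and
    `ρ̄_g ≅ Ind_K φ̄⁻¹` (KW + Hida; determinants match exactly because `det σ̄ = ε̄⁻¹`), made non-CM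
    by level-raising at one auxiliary prime if necessary; `ρ₀ := ρ_g^∨ ⊗ W`.  Then `ρ₀` is
    symplectic with multiplier `(m ε)⁻¹ · m = ε⁻¹` EXACTLY, irreducible (open image of `ρ_g`, Mackey),
    Greenberg `(0,0,1,1)` with no finite inertial junk (`m`, `θ` unramified at `p`), residually
    distinguished exactly by the pair's distinguishedness, `ρ̄₀^ss = Ind θ̄₁ ⊕ Ind(φ̄ θ̄^c) = σ̄ ⊕ σ̄'`
    (using `θ̄ᵢ^{1+c} = ε̄⁻¹|_K`), and automorphic (`π_g^∨ ⊠ π(Ind θ)`, Ramakrishnan; or AI∘BC).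
    This contains [c2]'s R3″ (`χ̄' = μ̄²`, `μ̄` strictly anticyclotomic: `μ̄² = μ̄^{1-c}`) and all
    odd-order `χ̄'`.
  * (D2, NEW, classification) Conversely every irreducible `Sh`-lift `ρ₀` of such a pair which is
    tensor-decomposable (`ρ ⊗ W`, `W` Artin) forces R1 or `χ̄' ∈ im(1-c)` (case analysis on `W̄`:
    reducible ⇒ twist pair; dihedral w.r.t. `K` ⇒ ratio `ᾱ^{1-c}` or `ν̄^{1-c}`; dihedral w.r.t.
    `K₁ ≠ K` ⇒ twist by `ω_{K₁}`; primitive `W̄` is impossible since `ad⁰W̄` irreducible forces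
    `ρ̄ ≅ ρ̄ ⊗ ω_K` and then `W̄|_K` splits).  Every `K₂`-IMPRIMITIVE irreducible `Sh`-lift
    `Ind_{K₂} τ` (any quadratic `K₂`) is polarised, `τ^c ≅ τ ⊗ ψ` with `ψ ∘ Ver ∈ {1, ω_{K₂}}`:
    if `ψ ∘ Ver = 1` then `ψ = ν^{c-1}`, `τ ⊗ ν` descends to `Γ_ℚ` (Schur: invariant irreducible of an
    index-2 subgroup extends over `ℚ̄_p`) and `ρ₀ = ρ ⊗ Ind ν` is decomposable; if
    `ψ ∘ Ver = ω_{K₂}` then `τ` is dihedral (projective descent: for non-dihedral `τ` the invariant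
    projective representation extends to `Γ_ℚ`, lifts by Tate, and gives `ψ ∘ Ver = 1`), so `ρ₀`
    is monomial from a quartic `L ⊃ K₂`, necessarily with Hodge type lifted from a CM subfield.
    For `K` REAL such monomial lifts contradict H5 (weights over an inert/ramified `w` would have to
    be equal, impossible when `Gal(L/K)` is complex conjugation; for split `w` the ratio `ω_{L/K}`
    is trivial on `Frob_w`, against distinguishedness); for `K` IMAGINARY they are R1 (ratio
    `ω_E|_K`, `p` inert in `E`).  CORRECTION to [c2] §5 R3(i): polarised parallel-weight-2 Hilbert
    newforms over real `K` ("`F^c ≅ F ⊗ η`") contribute NO case beyond D1/R1 — the "`ℓ₀ = 0`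
    Hilbert Eisenstein congruence" residue is empty.  Also (D3) the naive induction mechanism
    `det τ = ε⁻¹|_K` (un-polarised Hilbert forms of trivial central character) reaches only
    conjugate pairs `σ̄' ≅ σ̄`, excluded by H4.
  * RESIDUE of the dihedral regime (`p ≥ 5`): non-twist pairs with `χ̄' ∉ im(1-c)` (a 2-torsion
    obstruction class in `Ĥ⁻¹(Gal(K/ℚ), Hom(Γ_K, k^×))`), and, for `K` real, all pairs with `χ̄'`
    totally odd.  For these EVERY irreducible `Sh`-lift is primitive and tensor-indecomposable — a
    genuinely `GSp₄` weight-(2,2) object; decomposable lifts are excluded for totally odd `χ̄'` by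
    an evenness obstruction (they would need an even `ρ` with HT `(0,1)`, cf. Calegari), the first
    place in this problem where a SIGN kills a whole class of lifts.  No sign obstruction is known
    for primitive lifts.
R4 (generic `p ≥ 5`, large image) [c2]: open both ways; every candidate `ρ₀` primitive; twisted
  moduli `A₂(ρ̄)` of general type (Hulek–Sankaran) so no Diophantine supply; automorphic side is
  the irregular-weight (ℓ₀ = 1) existence problem (no level-raising theorem endoscopic → stable in
  weight (2,2); Sorensen2006 regular weight, Sorensen2009 SK only, LemmaOchiai2023 weight ≥ 4).
R5 parity [c2]: no epsilon/sign obstruction on the stable side; holomorphic endoscopic start needs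
  a common square-integrable place.  R6 fixed level [c2]: load-bearing (Poor–Yuen).  R7 cross-ratio
  supply [c2, computation CrossRatioSupply.py]: engine S1 fails exactly for projective images of
  order ≤ 10. -/
theorem regimes : True := trivial

/-! ## §6 What a kill needs -/

/-- **§6 `whatAKillNeeds` (paper).**  By `rigidPair_of_not_crux_of_sector` a refutation not
refuting conjunct (B) is a RIGID PAIR: an eligible ordinary `p`-distinguished Yoshida pair with NO
irreducible geometric symplectic-`ε⁻¹` lift of Hodge–Tate type `(0,0,1,1)` at ANY level.  This is an
irregular-weight NON-LIFTING theorem for `GSp₄/ℚ`.  Status [c3]: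
* Expected dimension of the relevant deformation problem is
  `dim(G/P_Siegel) - (dim sp₄ - dim sp₄^{c=1}) = 3 - 4 = -1` (odd similitude: `c` acts on
  `sp₄ ≅ Sym²(std) ⊗ ν⁻¹` with `+1`-eigenspace of dimension 4), independent of the auxiliary
  level (places `v ∤ p∞` contribute 0 to the Euler characteristic).  So lifts are "accidents"
  (motives, functorial constructions) — like weight-1 forms (`-1` as well) — but, unlike weight 1,
  the accidents are NOT classified (no finite-image constraint), so no non-existence proof is
  available for any pair.  The weight-1 finite-image obstruction does not transfer. [c1,c3]
* Where we can see (R1, R2, D1) the statement is TRUE for motivic/functorial reasons; the residues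
  (D-residue, R4) are exactly where only primitive `GSp₄` objects could serve, and there neither a
  construction nor an obstruction is known; the only sign phenomenon found (D2, totally odd `χ̄'`)
  kills decomposable lifts only.
* Nearest rigidity theorems in print [c3 literature pass; local searchd rc 75 and OpenAlex 429 all
  cycle, zbMATH/arXiv/galaxy reachable]: (i) Deo–Palvannan, arXiv:2602.20737 (2026), Thm
  (thm:nomore): under big residual image (`SL₂(𝔽_p)² ⊂ im`), minimal `R = 𝕋` and pseudo-nullity
  hypotheses, a `GSp₄` Hida family with a DENSE set of de Rham weight-`(k,2)` specialisations is a
  family of stable Yoshida lifts (automorphic inductions from a real quadratic field) — a `GSp₄`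
  Ghate–Vatsal: singular-weight geometric points are sparse off the functorial components.  It
  concerns residually IRREDUCIBLE `Ind_K τ̄` and families, not single weight-(2,2) points of a
  residually reducible `ρ̄`, so it yields no rigid pair; it is the right literature anchor for the
  "accidents only" picture.  (ii) Fakhruddin–Khare–Patrikis, arXiv:2202.00405 (PJM 2022):
  geometric lifts need regular local lifts + oddness; dropping "geometric" to "trianguline" restores
  existence — matching the fact that our pairs have plenty of ordinary NON-de-Rham lifts (the Hida
  family) and the whole difficulty is de Rham-ness at the singular weight.
* Not reachable by computation: `¬CruxAt` quantifies over all levels; LMFDB-type censuses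
  (paramodular forms, genus-2 curves) can only FIND lifts, never exclude them.  The informal census
  item stmt-Langlands-13864 is the constructive side.
* Lean: blocked outright by §2 for every variant.
* Misstatement angles tried and failed [c1–c3]: vacuity of `AutGL2` (no: `hcpt₂`, `ι` inhabited),
  junk `red`/`k` (no: forced), junk frames in `Sh` (no), `P = 0` junk in `HasFrobCharpolyAt` (no:
  `primesAbove` nonempty, charpoly monic), orientation of the shape (correct), missing oddness
  (derivable), `p = 2` (excluded), `p = 3` (engine hazard only), conjugate/twist pairs (H4 / R1).
VERDICT: RESISTS (open problem of singular-weight-deficit type); nothing refutable, nothing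
misstated. -/
theorem whatAKillNeeds : True := trivial

end

end Summit.Langlands.Langlands.Cruxes.StableYoshidaCongruence.Disproof
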